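import Literature.Probability.LatticeModels.DartPhase
import Literature.Probability.LatticeModels.DirichletGreenFunction
import Literature.Probability.RandomPlanarGeometry.PlanarDomains
import Summits.CriticalPhenomena.CardyFormulaZ2.Theorems.CardySusyWardParafermionPrecompactKenyonDefs
import Summits.CriticalPhenomena.CardyFormulaZ2.Theorems.CardySusyWardParafermionPrecompactVertexRelationGeometry
import Summits.CriticalPhenomena.CardyFormulaZ2.Theorems.CardySusyWardParafermionPrecompactPairIdentity
import Summits.CriticalPhenomena.CardyFormulaZ2.Theorems.CardySusyWardParafermionPrecompactFlipInvariance
import Summits.CriticalPhenomena.CardyFormulaZ2.Theorems.CardySusyWardParafermionPrecompactDartDictionary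

/-!
# Stub `stub_vertexRelation` of the line `kenyon-stream-second-relation` (crux `ParafermionPrecompact`)

Route `CardySusyWard`, item stmt-CriticalPhenomena-11293, lead
`prover-line-stmt-CriticalPhenomena-11293-0`. The EXACT VERTEX RELATION of
Duminil-Copin–Smirnov 2012, Prop. 8.6 (= Duminil-Copin 2012, Prop. 4) at `q = 1`, spin `σ = 1/3`,
for the tree's dart field `dartField E = bondDartObservable E E.δ (1/3)`: for a discrete Dobrushin
datum `E` that is admissible and lives in a Jordan domain (`E.Ω = D.carrier`), at every genuine
medial vertex `mv p` whose closed `2δ`-neighbourhood lies in the domain,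
`Φ(NW) - Φ(SE) = i [Φ(NE) - Φ(SW)]`, i.e. `vRes (dartField E) p = 0` (vocabulary of
`…KenyonDefs.lean`, coefficient `c = +i`, clockwise `NW, NE, SE, SW`).

Proof (`relField_eq_zero`): write the four corners around the in-dart `P` of the edge
(`cornersAt_zero_eq` / `cornersAt_one_eq`; at a horizontal edge the relation is `-i` times the
residual at `P`, `rel_rotate`). If the vertex of `P` is not in `Ω_δ`, the two faces of the edge are
not inner and all four fields vanish (`dartPhaseSum_eq_zero_of_not_isInnerFace`). Otherwise all
faces at both endpoints are inner (`faces_inner_of_ball`), the residual is the `P_{1/2}`-integral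
of the combination `g` of the four dart phase sums (`integrable_dartPhaseSum`), the involution
`ω ↦ ω ∆ {e}` preserves `P_{1/2}` (`integral_comp_symmDiff_singleton`), and `g ∘ (· ∆ {e}) = -g`
pointwise: the explorations are cut orbits (`medialExploration_eq_explorationList`), their dart
phase sums are dart sums (`dartPhaseSum_explorationList`), and the dart sums of the pair cancel
(`pair_rel_add_eq_zero`, whose orientation input `excisedLoop_turnSign_sum` is where the Jordan
carrier is used). Hence `∫ g = -∫ g = 0`.

References: H. Duminil-Copin, S. Smirnov, Clay Math. Proc. 15 (2012), §8.3 Prop. 8.6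
[DuminilCopinSmirnov2012Lattice]; H. Duminil-Copin, J. Phys. A 45 (2012) 494013, Prop. 4
[DuminilCopin2012Parafermion]; G. Grimmett, *Percolation* (1999), §1.3 [Grimmett1999].
-/

noncomputable section

namespace Summit.CriticalPhenomena.CardyFormulaZ2.Cruxes.ParafermionPrecompact.KenyonStreamSecondRelation

open Finset
open _root_.Literature.Topology.PlaneTopology _root_.Literature.Topology.PlaneTopology.RectLoop
open _root_.Literature.Probability.LatticeModels
open _root_.Literature.Probability.Percolation (BondConfig bondPercolation half)
open _root_.Literature.Probability.RandomPlanarGeometry (DobrushinDomain)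

/-! ## The vertex relation -/

section Final

open Complex MeasureTheory Metric

variable {E : DiscreteDobrushin}

/-- Rotating the relation by `-i`: the horizontal form from the vertical one. [folklore] -/
theorem rel_rotate {a b c d : ℂ} (h : a - b - I * (c - d) = 0) : d - c - I * (a - b) = 0 := by
  linear_combination (-I) * h + (d - c) * Complex.I_sq

/-- **The dart-field residual at an in-dart `P` of a `2δ`-deep edge vanishes**:
`Φ(P) - Φ(P₂) - i (Φ(P⁺) - Φ(P₂⁺)) = 0` for the spin-`1/3` dart field `Φ = dartField E` of an
admissible datum with Jordan carrier, `P₂` the partner of `P`, `q⁺ = (q.1, q.2 + 1)`. If the vertex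
of `P` is not in `Ω_δ`, the four faces (the two faces of the edge) are not inner and all four
fields vanish; otherwise all faces at both endpoints are inner (`faces_inner_of_ball`), the
residual is the `P_{1/2}`-integral of the combination `g` of the four dart phase sums, the flip
`ω ↦ ω ∆ {e}` preserves `P_{1/2}` (`integral_comp_symmDiff_singleton`) and `g ∘ flip = -g`
pointwise (`pair_rel_add_eq_zero` through `dartPhaseSum_explorationList`), so `∫ g = -∫ g = 0`.
[cite: DuminilCopinSmirnov2012Lattice, §8.3 Prop. 8.6] -/
theorem relField_eq_zero (D : DobrushinDomain) (hΩ : E.Ω = D.carrier) (hE : E.IsZdAdmissible) (P : Site 2 × Fin 4)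
    (hball : closedBall (medialPoint E.δ (cTgt P)) (2 * E.δ) ⊆ E.Ω) :
    dartField E (P.1, cFace P) - dartField E ((cornerPartner P).1, cFace (cornerPartner P)) -
      I * (dartField E ((P.1, P.2 + 1).1, cFace (P.1, P.2 + 1)) -
        dartField E (((cornerPartner P).1, (cornerPartner P).2 + 1).1,
          cFace ((cornerPartner P).1, (cornerPartner P).2 + 1))) = 0 := by
  obtain ⟨v, k⟩ := P
  dsimp only
  have hδ := hE.delta_pos
  -- the four faces are the two faces of `e`
  have hf1 : cFace (cornerPartner (v, k)) = faceAt v (k + 1) := by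
    change faceAt (v + cornerUnit (k + 1)) (k + 2) = _
    rw [← fin4_add_one_add_one, faceAt_add_unit_succ]
  have hf2 : cFace ((cornerPartner (v, k)).1, (cornerPartner (v, k)).2 + 1) = faceAt v k := by
    change faceAt (v + cornerUnit (k + 1)) (k + 2 + 1) = _
    rw [fin4_add_two_add_one, show k + 3 = (k + 1) + 2 from (fin4_add_one_add_two k).symm,
      faceAt_add_unit_add_two, fin4_add_one_add_three]
  by_cases hvD : v ∈ meshDomain E.Ω E.δ
  swap
  · -- the vertex is not in `Ω_δ`: no face at it is inner, all four dart fields vanish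
    have hn : ∀ j, ¬ E.IsInnerFace (faceAt v j) := fun j h =>
      hvD (mem_meshDomain_of_isCorner_of_isInnerFace (isCorner_faceAt _ _) h)
    have hz : ∀ r : Site 2 × Fin 4, (cFace r = faceAt v k ∨ cFace r = faceAt v (k + 1)) →
        dartField E (r.1, cFace r) = 0 := by
      intro r hr
      have hr' : ¬ E.IsInnerFace (cFace r) := by rcases hr with h | h <;> rw [h] <;> exact hn _
      simp only [dartField, Parafermion.bondDartObservable_def,
        dartPhaseSum_eq_zero_of_not_isInnerFace E _ _ _ _ hr', integral_zero]
    have e1 := hz (v, k) (Or.inl rfl)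
    have e2 := hz _ (Or.inr hf1)
    have e3 := hz (v, k + 1) (Or.inr rfl)
    have e4 := hz _ (Or.inl hf2)
    dsimp only at e1 e3 e4
    rw [e1, e2, e3, e4]
    ring
  · obtain ⟨hx, hy⟩ := faces_inner_of_ball hδ hvD hball
    have hedge : cTgt (v, k) ∈ (zdGraph 2).edgeSet := cTgt_mem_edgeSet (v, k)
    -- the four dart phase sums of one configuration, and their combination
    set f1 : BondConfig (Site 2) → ℂ := fun ω =>
      Parafermion.dartPhaseSum (medialExploration E ω) E.δ (1 / 3) (v, cFace (v, k)) with hf1d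
    set f2 : BondConfig (Site 2) → ℂ := fun ω =>
      Parafermion.dartPhaseSum (medialExploration E ω) E.δ (1 / 3) ((cornerPartner (v, k)).1, cFace (cornerPartner (v, k)))
      with hf2d
    set f3 : BondConfig (Site 2) → ℂ := fun ω =>
      Parafermion.dartPhaseSum (medialExploration E ω) E.δ (1 / 3) (v, cFace (v, k + 1)) with hf3d
    set f4 : BondConfig (Site 2) → ℂ := fun ω =>
      Parafermion.dartPhaseSum (medialExploration E ω) E.δ (1 / 3)
        ((cornerPartner (v, k)).1, cFace ((cornerPartner (v, k)).1, (cornerPartner (v, k)).2 + 1)) with hf4d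
    set g : BondConfig (Site 2) → ℂ := fun ω => (f1 ω - f2 ω) - I * (f3 ω - f4 ω) with hg
    -- pointwise: `g (ω ∆ {e}) = -g ω`
    have hpt : ∀ ω, g (symmDiff ω {cTgt (v, k)}) = -g ω := by
      intro ω
      rw [eq_neg_iff_add_eq_zero, add_comm]
      obtain ⟨hagree, hdiff, hB⟩ := toggle_hypotheses_symmDiff (p := (v, k)) hx hy ω
      have key := pair_rel_add_eq_zero D E hΩ hE ω (symmDiff ω {cTgt (v, k)}) (DiscreteDobrushin.startCorner hE) (v, k)
        (DiscreteDobrushin.isStartCorner_startCorner hE) hagree hdiff hB hx hy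
        (DiscreteDobrushin.exitTime hE ω) (DiscreteDobrushin.exitTime hE (symmDiff ω {cTgt (v, k)}))
        (DiscreteDobrushin.not_isInnerFace_exitTime hE _)
        (fun k hk => DiscreteDobrushin.isInnerFace_of_lt_exitTime hE _ hk)
        (DiscreteDobrushin.not_isInnerFace_exitTime hE _)
        (fun k hk => DiscreteDobrushin.isInnerFace_of_lt_exitTime hE _ hk)
      dsimp only at key
      simp only [hg, hf1d, hf2d, hf3d, hf4d, DiscreteDobrushin.medialExploration_eq_explorationList hE,
        dartPhaseSum_explorationList hδ.ne', dartPhaseSum_explorationList' hδ.ne']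
      exact key
    -- the integral of `g` is its own negative
    have hI : ∫ ω, g ω ∂(bondPercolation (zdGraph 2) half) = 0 := by
      have h1 := integral_comp_symmDiff_singleton hedge g
      simp only [hpt, integral_neg] at h1
      have h2 : (∫ ω, g ω ∂(bondPercolation (zdGraph 2) half)) +
          ∫ ω, g ω ∂(bondPercolation (zdGraph 2) half) = 0 := by
        linear_combination -h1
      exact add_self_eq_zero.1 h2
    have i1 : Integrable f1 (bondPercolation (zdGraph 2) half) := integrable_dartPhaseSum E _ _ _
    have i2 : Integrable f2 (bondPercolation (zdGraph 2) half) := integrable_dartPhaseSum E _ _ _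
    have i3 : Integrable f3 (bondPercolation (zdGraph 2) half) := integrable_dartPhaseSum E _ _ _
    have i4 : Integrable f4 (bondPercolation (zdGraph 2) half) := integrable_dartPhaseSum E _ _ _
    have hsplit : ∫ ω, g ω ∂(bondPercolation (zdGraph 2) half) =
        ((∫ ω, f1 ω ∂(bondPercolation (zdGraph 2) half)) - ∫ ω, f2 ω ∂(bondPercolation (zdGraph 2) half)) -
          I * ((∫ ω, f3 ω ∂(bondPercolation (zdGraph 2) half)) - ∫ ω, f4 ω ∂(bondPercolation (zdGraph 2) half)) := by
      have iA : Integrable (fun ω => f1 ω - f2 ω) (bondPercolation (zdGraph 2) half) := i1.sub i2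
      have iB : Integrable (fun ω => I * (f3 ω - f4 ω)) (bondPercolation (zdGraph 2) half) := (i3.sub i4).const_mul I
      simp only [hg]
      rw [integral_sub iA iB, integral_sub i1 i2, integral_const_mul, integral_sub i3 i4]
    simp only [dartField, Parafermion.bondDartObservable_def]
    rw [hsplit] at hI
    exact hI

/-- **Registered stub `stub_vertexRelation`** of the line `kenyon-stream-second-relation`: the
exact vertex relation of Duminil-Copin–Smirnov 2012, Prop. 8.6 (= Duminil-Copin 2012, Prop. 4) at
`q = 1`, spin `1/3`, for the tree's dart field: at every genuine medial vertex whose closed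
`2δ`-neighbourhood lies in the (Jordan) domain, `Φ(NW) - Φ(SE) = i [Φ(NE) - Φ(SW)]`. At a
vertical edge this is the residual at the in-dart in position `NW`; at a horizontal edge it is
`-i` times the residual at the in-dart in position `NE` (`rel_rotate`).
[cite: DuminilCopinSmirnov2012Lattice, §8.3 Prop. 8.6] -/
theorem stub_vertexRelation :
    ∀ (D : DobrushinDomain) (E : DiscreteDobrushin), E.Ω = D.carrier → E.IsZdAdmissible →
      ∀ p : Site 2 × Fin 2,
        Metric.closedBall (medialPoint E.δ (mv p)) (2 * E.δ) ⊆ E.Ω → vRes (dartField E) p = 0 := by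
  intro D E hΩ hE p hball
  obtain ⟨y, i⟩ := p
  have hi : i = 0 ∨ i = 1 := by fin_cases i <;> simp
  rcases hi with rfl | rfl
  · obtain ⟨c1, c3, c2, c0⟩ := cornersAt_zero_eq y
    rw [(mv_eq_cTgt y).1] at hball
    have key := relField_eq_zero D hΩ hE (y + cornerUnit 0, 1) hball
    change dartField E (cornersAt y 0 0) - dartField E (cornersAt y 0 2) -
      I * (dartField E (cornersAt y 0 1) - dartField E (cornersAt y 0 3)) = 0
    rw [c0, c1, c2, c3]
    exact rel_rotate key
  · obtain ⟨c0, c2, c1, c3⟩ := cornersAt_one_eq y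
    rw [(mv_eq_cTgt y).2] at hball
    have key := relField_eq_zero D hΩ hE (y + cornerUnit 1, 2) hball
    change dartField E (cornersAt y 1 0) - dartField E (cornersAt y 1 2) -
      I * (dartField E (cornersAt y 1 1) - dartField E (cornersAt y 1 3)) = 0
    rw [c0, c1, c2, c3]
    exact key

end Final

end Summit.CriticalPhenomena.CardyFormulaZ2.Cruxes.ParafermionPrecompact.KenyonStreamSecondRelation

end
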